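import Summits.BirchSwinnertonDyer.Rank1Residual.X4.CharacterTwistTransport
import Mathlib.NumberTheory.JacobiSum.Basic
import HarnessLib

/-!
# Level lowering kills Kurihara numbers mod `p`, part 4f: twisting DOWN AND UP costs `p` — the Jacobi-sum identity `T_χ T_{χ⁻¹} μ = χ(-1)·(p·μ − U_p-sum)`, the depletion recursion, and the characteristic-`p` NO-GO for the principal-series template (cell `b2b-bsdres`, seat additive-p4, line V80)

HONEST FRAMING (verbatim, cell `b2b-bsdres`): the goal of the cell is to DELETE the COMBINATION-SHAPED
residual classes for ALL analytic-rank `≤ 1` curves over `ℚ` — "full BSD formula for every rank `≤ 1`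
curve in class `C`" assembled STRICTLY from published theorems — so that the rank-`≤ 1` remainder
becomes exactly the CONSTRUCTION-SHAPED classes, which are TYPED (missing-input Props), NOT attempted;
this is not "finishing BSD". This file: research-route KERNEL THEOREMS (finite sums over `ℤ/p` and
Mathlib's `jacobiSum`; no named fact, no conjecture, no definition, nothing booked; class X4 stays
CONSTRUCTION-SHAPED).

## What is proved

Parts 4b–4e transport the level-lowering certificate along `f_W = g ⊗ χ̄` (a principal-series prime
`p` of `W`, `χ` of conductor `p` and order `e ∣ p − 1`) and reduce its analytic input `hsym` to
(RAT) + (ALG) + (PER). On such a row the source is recovered from `W` ITSELF: `f_W ⊗ χ` is the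
`p`-DEPLETION `g^{(p)} = g − a_p(g)·g(pτ)` of `g` (nebentypus of conductor `p` ⇒ `a_{pn} = a_p a_n`),
so at the level of symbols `σ_g(x) = λ·σ_g(px) + c·T_{χ⁻¹}μ_W(x)` with `λ = a_p(g)/p`,
`T_ψ μ(x) := ∑_{v mod p} ψ(v) μ(x + v/p)`. This file proves the two identities that govern this
recursion, for any commutative domain `R`, any `μ : ℚ → R` periodic, any NON-TRIVIAL multiplicative
character `χ : (ℤ/p) → R`:

* §1 **`twistSum_twistSum_inv`** — TWISTING DOWN AND UP COSTS `p`: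
  `∑_u χ(u) ∑_v χ⁻¹(v) μ(r + u/p + v/p) = χ(−1)·(p·μ(r) − ∑_{w mod p} μ(r + w/p))`
  (the inner coefficient of `μ(r + w/p)` is `χ(−1)(p − 1)` at `w = 0` and the Jacobi sum
  `J(χ, χ⁻¹) = −χ(−1)` at `w ≠ 0` — Mathlib's `jacobiSum_nontrivial_inv`); with a `U_p`-relation
  `∑_w μ(s + w/p) = a·μ(ps)` this is `χ(−1)(p·μ(r) − a·μ(pr))` (`twistSum_twistSum_inv_of_Up`).
* §2 **`twistSum_of_depletion`** — if `σ(x) = λσ(px) + c·T_{χ⁻¹}μ(x)` for all `x` (`σ` periodic),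
  then `T_χ σ(r) = c·χ(−1)·(p·μ(r) − ∑_w μ(r + w/p))`: the `λ`-term drops out because
  `∑_u χ(u) = 0`.
* §3 THE CHARACTERISTIC-`p` NO-GO **`eq_zero_of_hsym_of_depletion`**: if `p = 0` in `R` (e.g.
  `R = ℤ/p`) and `U_p μ = 0` (`∑_w μ(s + w/p) = 0` — the shape of `f_W`, `p² ∣ N_W`), then `T_χ σ = 0`
  identically for ANY `σ` satisfying the depletion identity with `c ∈ R`; so an identity
  `Λ(r) = c₀·T_χσ(r)` (part 4b's `hsym`) forces `Λ ≡ 0`. READING: the reduced source symbol `σ` of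
  part 4b can NOT be a reduction in which the depletion identity holds with an INTEGRAL constant —
  the honest `σ` is the PRIMITIVE source symbol, whose depletion constant has a pole of order
  exactly one at the prime through which one reduces (the period module of `g` sits at index `(p)`
  below the twisted module of `W`; part 4e's (PER) constant is then a unit). This is the structure the
  seat's exact instrument E22 observed on the cell's row 11760bb1 at `p = 7` (`(v_𝔭, v_𝔭̄) = (1, 1)`,
  `c₀ = 4 = 1/2 mod 7`); nothing about that row is proved here.

## References

* K. Ireland, M. Rosen, *A classical introduction to modern number theory*, GTM 84, §8.3 (Jacobi
  sums). [cite: IrelandRosen1990, §8.3]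
* G. Shimura, *Introduction to the arithmetic theory of automorphic functions* (1971), Prop. 3.64.
  [cite: Shimura1971, Prop. 3.64]
* B. Mazur, J. Tate, J. Teitelbaum, Invent. Math. 84 (1986), §I.8. [cite: MazurTateTeitelbaum1986Invent, §I.8]
-/

noncomputable section

open Finset

open Summit.BirchSwinnertonDyer.Rank1Residual.LevelLowering

namespace Summit.BirchSwinnertonDyer.Rank1Residual.NebentypusTwist

variable {p : ℕ} [hp : Fact p.Prime] {R : Type*} [CommRing R] [IsDomain R]

/-! ### §1 Twisting down and up costs `p` -/

section DownUp

variable (χ : MulChar (ZMod p) R) {μ : ℚ → R}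

omit [CommRing R] [IsDomain R] in
/-- A periodic `μ` evaluated at `s + n/p` only sees `n mod p`. [folklore] -/
private theorem apply_add_natCast_div (hμ : IsPeriodic μ) (s : ℚ) (n : ℕ) :
    μ (s + (n : ℚ) / p) = μ (s + (((n : ZMod p).val : ℕ) : ℚ) / p) := by
  rw [ZMod.val_natCast]
  have hp0 : (p : ℚ) ≠ 0 := by exact_mod_cast hp.out.ne_zero
  have hk : ((n % p : ℕ) : ℚ) = (n : ℚ) - (p : ℚ) * ((n / p : ℕ) : ℚ) := by
    have h' : ((n % p : ℕ) : ℚ) + (p : ℚ) * ((n / p : ℕ) : ℚ) = (n : ℚ) := by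
      exact_mod_cast Nat.mod_add_div n p
    linarith
  refine hμ.eq_of_eq_add_int ((n / p : ℕ) : ℤ) ?_
  rw [Int.cast_natCast, hk]
  field_simp
  ring

omit [CommRing R] [IsDomain R] in
/-- `μ(r + u/p + v/p) = μ(r + (u + v)/p)` for a periodic `μ` (`u, v` read in `[0, p)`; the two
arguments differ by the integer `⌊(u + v)/p⌋`). [folklore] -/
theorem apply_add_val_add_val (hμ : IsPeriodic μ) (r : ℚ) (u v : ZMod p) :
    μ (r + (u.val : ℚ) / p + (v.val : ℚ) / p) = μ (r + (((u + v).val : ℕ) : ℚ) / p) := by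
  have h1 : r + (u.val : ℚ) / p + (v.val : ℚ) / p = r + ((u.val + v.val : ℕ) : ℚ) / p := by
    push_cast; ring
  rw [h1, apply_add_natCast_div hμ, Nat.cast_add, ZMod.natCast_zmod_val, ZMod.natCast_zmod_val]

omit [IsDomain R] in
/-- `χ(w) χ⁻¹(w) = 1` for a unit `w`. [folklore] -/
theorem apply_mul_inv_apply {w : ZMod p} (hw : IsUnit w) : χ w * χ⁻¹ w = 1 := by
  rw [← MulChar.mul_apply, mul_inv_cancel, MulChar.one_apply hw]

/-- `χ⁻¹(−1) = χ(−1)` (`(−1)² = 1`). [folklore] -/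
theorem inv_apply_neg_one : χ⁻¹ (-1 : ZMod p) = χ (-1) := by
  have h : χ (-1 : ZMod p) * χ (-1) = 1 := by
    rw [← map_mul, neg_one_mul, neg_neg, map_one]
  have hu : IsUnit (-1 : ZMod p) := isUnit_one.neg
  have h2 : χ (-1 : ZMod p) * χ⁻¹ (-1) = 1 := apply_mul_inv_apply χ hu
  -- both `χ(-1)` and `χ⁻¹(-1)` are inverses of `χ(-1)`
  have hne : χ (-1 : ZMod p) ≠ 0 := fun h0 ↦ by simp [h0] at h
  exact mul_left_cancel₀ hne (h2.trans h.symm)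

omit [IsDomain R] in
/-- **The Jacobi reindexing**: for `w ≠ 0`, `∑_u χ(u) χ⁻¹(w − u) = J(χ, χ⁻¹)` (substitute `u = wx`).
[cite: IrelandRosen1990, §8.3] -/
theorem sum_apply_mul_inv_apply_sub {w : ZMod p} (hw : w ≠ 0) :
    ∑ u : ZMod p, χ u * χ⁻¹ (w - u) = jacobiSum χ χ⁻¹ := by
  rw [jacobiSum, ← Equiv.sum_comp (Equiv.mulLeft₀ w hw)]
  refine Finset.sum_congr rfl fun x _ ↦ ?_
  rw [Equiv.mulLeft₀_apply, show w - w * x = w * (1 - x) by ring, map_mul, map_mul]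
  have h1 : χ w * χ⁻¹ w = 1 := apply_mul_inv_apply χ (Ne.isUnit hw)
  linear_combination (χ x * χ⁻¹ (1 - x)) * h1

/-- **The diagonal term**: `∑_u χ(u) χ⁻¹(0 − u) = χ(−1)·(p − 1)`. [cite: IrelandRosen1990, §8.3] -/
theorem sum_apply_mul_inv_apply_neg :
    ∑ u : ZMod p, χ u * χ⁻¹ (0 - u) = χ (-1) * ((p : R) - 1) := by
  classical
  have hterm : ∀ u : ZMod p, χ u * χ⁻¹ (0 - u) = χ (-1) * (1 : MulChar (ZMod p) R) u := by
    intro u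
    rw [zero_sub, neg_eq_neg_one_mul, map_mul, inv_apply_neg_one, ← mul_inv_cancel χ,
      MulChar.mul_apply]
    ring
  simp_rw [hterm]
  rw [← Finset.mul_sum, MulChar.sum_one_eq_card_units, ZMod.card_units_eq_totient,
    Nat.totient_prime hp.out, Nat.cast_sub hp.out.one_le, Nat.cast_one]

/-- The inner coefficient as a function of `w`: `−χ(−1) + [w = 0]·χ(−1)·p`. [folklore] -/
theorem sum_apply_mul_inv_apply_sub_eq (hχ : χ ≠ 1) (w : ZMod p) :
    ∑ u : ZMod p, χ u * χ⁻¹ (w - u) = -χ (-1) + if w = 0 then χ (-1) * (p : R) else 0 := by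
  by_cases hw : w = 0
  · subst hw
    rw [sum_apply_mul_inv_apply_neg, if_pos rfl]
    ring
  · rw [sum_apply_mul_inv_apply_sub χ hw, jacobiSum_nontrivial_inv hχ, if_neg hw, add_zero]

/-- **TWISTING DOWN AND UP COSTS `p`.** For a non-trivial multiplicative character `χ` of `ℤ/p` with
values in a domain `R` and a periodic `μ : ℚ → R`:
`∑_{u mod p} χ(u) ∑_{v mod p} χ⁻¹(v) μ(r + u/p + v/p) = χ(−1)·(p·μ(r) − ∑_{w mod p} μ(r + w/p))` —
the twist by `χ` of the twist by `χ⁻¹` is `χ(−1)` times (`p` − the `U_p`-sum). (The coefficient of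
`μ(r + w/p)` is the Jacobi sum `J(χ, χ⁻¹) = −χ(−1)` for `w ≠ 0` and `χ(−1)(p−1)` for `w = 0`.)
[cite: IrelandRosen1990, §8.3] [cite: MazurTateTeitelbaum1986Invent, §I.8] -/
theorem twistSum_twistSum_inv (hχ : χ ≠ 1) (hμ : IsPeriodic μ) (r : ℚ) :
    ∑ u : ZMod p, χ u * ∑ v : ZMod p, χ⁻¹ v * μ (r + (u.val : ℚ) / p + (v.val : ℚ) / p) =
      χ (-1) * ((p : R) * μ r - ∑ w : ZMod p, μ (r + (w.val : ℚ) / p)) := by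
  classical
  -- Step 1: reindex the inner sum by `w = u + v` and use periodicity.
  have hinner : ∀ u : ZMod p, ∑ v : ZMod p, χ⁻¹ v * μ (r + (u.val : ℚ) / p + (v.val : ℚ) / p) =
      ∑ w : ZMod p, χ⁻¹ (w - u) * μ (r + (w.val : ℚ) / p) := by
    intro u
    rw [← Equiv.sum_comp (Equiv.subRight u)]
    refine Finset.sum_congr rfl fun w _ ↦ ?_
    rw [Equiv.subRight_apply, apply_add_val_add_val hμ r u (w - u), add_sub_cancel]
  simp_rw [hinner, Finset.mul_sum]
  -- Step 2: swap the sums and evaluate the inner coefficient.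
  rw [Finset.sum_comm]
  have hcoef : ∀ w : ZMod p, ∑ u : ZMod p, χ u * (χ⁻¹ (w - u) * μ (r + (w.val : ℚ) / p)) =
      (-χ (-1) + if w = 0 then χ (-1) * (p : R) else 0) * μ (r + (w.val : ℚ) / p) := by
    intro w
    rw [← sum_apply_mul_inv_apply_sub_eq χ hχ w, Finset.sum_mul]
    exact Finset.sum_congr rfl fun u _ ↦ by ring
  simp_rw [hcoef, add_mul, Finset.sum_add_distrib, ite_mul, zero_mul, Finset.sum_ite_eq', if_pos
    (Finset.mem_univ _), ZMod.val_zero, Nat.cast_zero, zero_div, add_zero, ← Finset.mul_sum]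
  ring

/-- The same with a **`U_p`-relation** `∑_{w mod p} μ(s + w/p) = a·μ(ps)`:
`T_χ T_{χ⁻¹} μ(r) = χ(−1)·(p·μ(r) − a·μ(pr))`. [cite: MazurTateTeitelbaum1986Invent, §I.8] -/
theorem twistSum_twistSum_inv_of_Up (hχ : χ ≠ 1) (hμ : IsPeriodic μ) {a : R}
    (hU : ∀ s : ℚ, ∑ w : ZMod p, μ (s + (w.val : ℚ) / p) = a * μ (p * s)) (r : ℚ) :
    ∑ u : ZMod p, χ u * ∑ v : ZMod p, χ⁻¹ v * μ (r + (u.val : ℚ) / p + (v.val : ℚ) / p) =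
      χ (-1) * ((p : R) * μ r - a * μ (p * r)) := by
  rw [twistSum_twistSum_inv χ hχ hμ r, hU r]

end DownUp

/-! ### §2 The depletion recursion -/

section Depletion

variable (χ : MulChar (ZMod p) R) {μ σ : ℚ → R}

omit [CommRing R] [IsDomain R] in
/-- `σ(p·(r + u/p)) = σ(pr)` for a periodic `σ` (the shift `u` is an integer). [folklore] -/
theorem apply_mul_add_val (hσ : IsPeriodic σ) (r : ℚ) (u : ZMod p) :
    σ (p * (r + (u.val : ℚ) / p)) = σ (p * r) := by
  have hp0 : (p : ℚ) ≠ 0 := by exact_mod_cast hp.out.ne_zero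
  have h : (p : ℚ) * (r + (u.val : ℚ) / p) = p * r + ((u.val : ℤ) : ℚ) := by
    rw [Int.cast_natCast]; field_simp
  rw [h]
  exact hσ (p * r) u.val

/-- **THE TWIST OF A DEPLETED SYMBOL.** If `σ` (periodic) satisfies the DEPLETION IDENTITY
`σ(x) = λ·σ(px) + c·∑_{v mod p} χ⁻¹(v) μ(x + v/p)` for all `x` (`μ` periodic, `χ ≠ 1`), then
`∑_{u mod p} χ(u) σ(r + u/p) = c·χ(−1)·(p·μ(r) − ∑_{w mod p} μ(r + w/p))`: the `λ`-term contributes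
`λσ(pr)·∑_u χ(u) = 0`. This is the symbol-level shape of `f_W ⊗ χ = g − a_p(g)·g(p·)` for a
principal-series prime (`σ` = the source symbol, `μ` = the symbol of `f_W`, `λ = a_p(g)/p`,
`c = g(χ)⁻¹`). [cite: Shimura1971, Prop. 3.64] [cite: MazurTateTeitelbaum1986Invent, §I.8] -/
theorem twistSum_of_depletion (hχ : χ ≠ 1) (hμ : IsPeriodic μ) (hσ : IsPeriodic σ) {lam c : R}
    (hdep : ∀ x : ℚ, σ x = lam * σ (p * x) + c * ∑ v : ZMod p, χ⁻¹ v * μ (x + (v.val : ℚ) / p))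
    (r : ℚ) :
    ∑ u : ZMod p, χ u * σ (r + (u.val : ℚ) / p) =
      c * (χ (-1) * ((p : R) * μ r - ∑ w : ZMod p, μ (r + (w.val : ℚ) / p))) := by
  have hterm : ∀ u : ZMod p, χ u * σ (r + (u.val : ℚ) / p) =
      lam * σ (p * r) * χ u +
        c * (χ u * ∑ v : ZMod p, χ⁻¹ v * μ (r + (u.val : ℚ) / p + (v.val : ℚ) / p)) := by
    intro u
    rw [hdep (r + (u.val : ℚ) / p), apply_mul_add_val hσ r u]
    ring
  simp_rw [hterm]
  rw [Finset.sum_add_distrib, ← Finset.mul_sum, ← Finset.mul_sum, MulChar.sum_eq_zero_of_ne_one hχ,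
    mul_zero, zero_add, twistSum_twistSum_inv χ hχ hμ r]

end Depletion

/-! ### §3 The characteristic-`p` no-go -/

section NoGo

variable (χ : MulChar (ZMod p) R) {μ σ : ℚ → R}

/-- **In characteristic `p` with `U_p μ = 0` the twist of ANY depleted symbol vanishes**: if
`p = 0` in `R`, `∑_{w mod p} μ(s + w/p) = 0` for all `s` (the `U_p`-relation of `f_W` with
`a_p(W) = 0`, `p² ∣ N_W`), and `σ` satisfies the depletion identity with constants `λ, c ∈ R`, then
`∑_u χ(u) σ(r + u/p) = 0` for every `r`. [cite: MazurTateTeitelbaum1986Invent, §I.8] -/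
theorem twistSum_eq_zero_of_depletion_charP (hχ : χ ≠ 1) (hμ : IsPeriodic μ) (hσ : IsPeriodic σ)
    (hp0 : (p : R) = 0) (hU : ∀ s : ℚ, ∑ w : ZMod p, μ (s + (w.val : ℚ) / p) = 0) {lam c : R}
    (hdep : ∀ x : ℚ, σ x = lam * σ (p * x) + c * ∑ v : ZMod p, χ⁻¹ v * μ (x + (v.val : ℚ) / p))
    (r : ℚ) :
    ∑ u : ZMod p, χ u * σ (r + (u.val : ℚ) / p) = 0 := by
  rw [twistSum_of_depletion χ hχ hμ hσ hdep r, hU r, hp0]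
  ring

/-- **THE NO-GO FOR THE PRINCIPAL-SERIES TEMPLATE.** If a function `Λ` (the reduced plus symbol of
`f_W`) satisfies part 4b's `hsym`-shape `Λ(r) = c₀·∑_u χ(u) σ(r + u/p)` with a source symbol `σ`
for which the depletion identity holds IN `R` (characteristic `p`, `U_p μ = 0` where `μ` is any
periodic function — in the application `μ = Λ` itself), then `Λ ≡ 0`. Hence in every honest instance
of the template the reduced source symbol is one whose depletion constant is NOT integral at the
prime of reduction: the source's period module lies one power of that prime BELOW the twisted
module of `W` (part 4e's (PER) constant is then a unit). [cite: MazurTateTeitelbaum1986Invent, §I.8] -/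
theorem eq_zero_of_hsym_of_depletion (hχ : χ ≠ 1) (hμ : IsPeriodic μ) (hσ : IsPeriodic σ)
    (hp0 : (p : R) = 0) (hU : ∀ s : ℚ, ∑ w : ZMod p, μ (s + (w.val : ℚ) / p) = 0) {lam c : R}
    (hdep : ∀ x : ℚ, σ x = lam * σ (p * x) + c * ∑ v : ZMod p, χ⁻¹ v * μ (x + (v.val : ℚ) / p))
    {Λ : ℚ → R} {c₀ : R} (hsym : ∀ r : ℚ, Λ r = c₀ * ∑ u : ZMod p, χ u * σ (r + (u.val : ℚ) / p))
    (r : ℚ) : Λ r = 0 := by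
  rw [hsym r, twistSum_eq_zero_of_depletion_charP χ hχ hμ hσ hp0 hU hdep r, mul_zero]

/-- The `U_p = 0` relation is inherited by the twisted-back symbol: in the self-referential case
`μ = Λ` of the no-go (the depletion identity of the source built from `Λ` itself, as on a
principal-series row where `f_W ⊗ χ` is the depletion of the source), `Λ ≡ 0`.
[cite: MazurTateTeitelbaum1986Invent, §I.8] -/
theorem eq_zero_of_hsym_of_self_depletion (hχ : χ ≠ 1) {Λ : ℚ → R} (hΛ : IsPeriodic Λ)
    (hσ : IsPeriodic σ) (hp0 : (p : R) = 0)
    (hU : ∀ s : ℚ, ∑ w : ZMod p, Λ (s + (w.val : ℚ) / p) = 0) {lam c c₀ : R}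
    (hdep : ∀ x : ℚ, σ x = lam * σ (p * x) + c * ∑ v : ZMod p, χ⁻¹ v * Λ (x + (v.val : ℚ) / p))
    (hsym : ∀ r : ℚ, Λ r = c₀ * ∑ u : ZMod p, χ u * σ (r + (u.val : ℚ) / p)) (r : ℚ) :
    Λ r = 0 :=
  eq_zero_of_hsym_of_depletion χ hχ hΛ hσ hp0 hU hdep hsym r

end NoGo

end Summit.BirchSwinnertonDyer.Rank1Residual.NebentypusTwist

end
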